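import Summits.FinalStateConjecture.FinalStateConjecture.Theorems.SwallowTheDatumSubdataDevelopmentsEmbed
import Summits.FinalStateConjecture.FinalStateConjecture.Theorems.SwallowTheDatumSubdataDevelopmentsEmbedNcbDomain
import Summits.FinalStateConjecture.FinalStateConjecture.Theorems.SwallowTheDatumSubdataDevelopmentsEmbedHmaxGlue
import Summits.FinalStateConjecture.FinalStateConjecture.Theorems.SwallowTheDatumSubdataDevelopmentsEmbedRealise
import Literature.Geometry.Lorentzian.CauchyDevelopmentGlobalHyperbolicity

/-!
# Route SwallowTheDatum · item `SubdataDevelopmentsEmbed` (stmt-FinalStateConjecture-10053) —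
# the localisation principle from MGHD existence (no local uniqueness, no Theorem 12)

The previous reductions of the item (`…Skeleton`, `…Skeleton2`, `…Final`) glue the GIVEN
development `𝒟'` of the sub-datum `Φ^* D` to the maximal development `𝒟` of `D` along their
maximal relative common sub-development `(U, ψ)`; that `(U, ψ)` has no corresponding boundary
points is the relative form of Sbierski's Theorem 12 (2016, §3.2), whose proof needs local
geometric uniqueness across a spacelike piece of `∂U` — the named PDE fact
`hawkingEllis_locallyUnique_vacuumDevelopment` plus the unformalised §3.2.

This file proves the item from the EXISTENCE of maximal developments
(`choquetBruhat_geroch_exists_mghd_cauchy`, the named fact on which `MGHDExistence`,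
stmt-FinalStateConjecture-9937, is conditionally closed) and the global hyperbolicity of Cauchy
developments (`hawkingEllis_cauchyDevelopment_causalCompact_closed`, displayed here by name; it is
a theorem of the tree, `hawkingEllis_cauchyDevelopment_causalCompact_closed_holds` of
`CauchyDevelopmentGlobalHyperbolicityProofs`, substituted in the sequel), by gluing instead the
MAXIMAL development `M̃` of the sub-datum (into which `𝒟'` embeds) to `𝒟` along the WHOLE domain
of dependence `R = (V, g|_V, ι ∘ Φ)` of `ι(Φ N)` in `𝒟` (`exists_cauchyPieceDomain`,
`VacuumCauchyDevelopment.comapAlongRestrict`), realised inside `M̃` through the embedding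
`θ : R → M̃` given by maximality of `M̃` (`exists_realised_rel`). For THIS relative common
development no Theorem 12 is needed: a cluster point `q ∈ M` of `ψ = θ⁻¹` at a point of
`∂θ(R)` lies off the closure of `I⁺(K) ∪ I⁻(K) ∪ K`, `K = ι(X) ∖ ι(Φ N)`
(`not_mem_closure_badSet_of_clusterPt`, Hawking–Ellis 1973, §7.6), hence in `V = ψ(θ(R))`
itself (`V` is relatively closed in the complement of that closure), which is absurd for an
injective open map `ψ` on the open set `θ(R)` (`not_clusterPt_map_of_mem`). So the gluing
`Z = 𝒟 ∪_ψ M̃` is a vacuum Cauchy development of `D` receiving `M̃` over `Φ`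
(`hglue_of_relGluing`, `RelativeDevelopmentGluing`); maximality of `𝒟` absorbs `Z`, and
`𝒟' → M̃ → Z → 𝒟` is the embedding asked for:

* `subdataDevelopmentsEmbed_of_choquetBruhatGeroch_of_causalCompact :
    choquetBruhat_geroch_exists_mghd_cauchy → hawkingEllis_cauchyDevelopment_causalCompact_closed →
    SubdataDevelopmentsEmbed`.

This is the argument of Hawking–Ellis 1973, §7.6, p. 251 ("if `𝓢'` is a portion of `𝓢`, the
maximal development of `𝓢'` can be mapped into that of `𝓢`") and Choquet-Bruhat–Geroch 1969,
p. 334 (domain of dependence), run with the maximal development of the sub-datum so that the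
Hausdorff separation is settled by the domain of dependence rather than by Theorem 12.
Pure composition over the tree; no definition; no new named fact (the hypotheses are the
registered facts named above).
-/

noncomputable section

open Function Set Filter Topology TopologicalSpace Bundle
open scoped Manifold ContDiff Topology

namespace Summit.FinalStateConjecture.FinalStateConjecture.Theorems

namespace SubdataDevelopmentsEmbed

open Literature.Geometry.Lorentzian

universe u

/-! ### A topological lemma: no cluster values inside the image -/

/-- **An injective map which is open on the open set `U` has no cluster value `ψ y₀`, `y₀ ∈ U`,
along `U` at a point of the frontier of `U`**: a closed neighbourhood `B ⊆ U` of `y₀` has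
`ψ(int B ∩ U)` as a neighbourhood of `ψ y₀`, points of `U` near `p` mapped into it lie in `B`
(injectivity), so `p ∈ B ⊆ U`, while `p ∈ ∂U` and `U` is open. [folklore] -/
theorem not_clusterPt_map_of_mem {α β : Type*} [TopologicalSpace α] [TopologicalSpace β]
    [RegularSpace α] {U : Set α} (hU : IsOpen U) {ψ : α → β} (hinj : InjOn ψ U)
    (hopen : ∀ B : Set α, IsOpen B → IsOpen (ψ '' (B ∩ U))) {p : α} (hp : p ∈ frontier U)
    {y₀ : α} (hy₀ : y₀ ∈ U) : ¬ ClusterPt (ψ y₀) (map ψ (𝓝[U] p)) := by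
  intro hq
  obtain ⟨B, hBn, hBc, hBU⟩ := exists_mem_nhds_isClosed_subset (hU.mem_nhds hy₀)
  have hO : ψ '' (interior B ∩ U) ∈ 𝓝 (ψ y₀) :=
    (hopen _ isOpen_interior).mem_nhds ⟨y₀, ⟨mem_interior_iff_mem_nhds.2 hBn, hy₀⟩, rfl⟩
  have hpB : p ∈ closure B := by
    rw [mem_closure_iff_nhds]
    intro W hW
    have hmem : ψ '' (W ∩ U) ∈ map ψ (𝓝[U] p) :=
      image_mem_map (Filter.inter_mem (mem_nhdsWithin_of_mem_nhds hW) self_mem_nhdsWithin)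
    obtain ⟨z, hzO, hzW⟩ := (clusterPt_iff_nonempty.1 hq) hO hmem
    obtain ⟨b, ⟨hbB, hbU⟩, rfl⟩ := hzO
    obtain ⟨y, ⟨hyW, hyU⟩, hyb⟩ := hzW
    have hyb' : y = b := hinj hyU hbU hyb
    exact ⟨y, hyW, hyb' ▸ interior_subset hbB⟩
  rw [hBc.closure_eq] at hpB
  have hpU : p ∈ interior U := by rw [hU.interior_eq]; exact hBU hpB
  exact hp.2 hpU

variable {n : ℕ}
  {N : Type u} [TopologicalSpace N] [ChartedSpace (EuclideanSpace ℝ (Fin n)) N]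
  [IsManifold (𝓡 n) ∞ N] [ConnectedSpace N] {D₁ : InitialDataSet (𝓡 n) N}
  {X : Type u} [TopologicalSpace X] [ChartedSpace (EuclideanSpace ℝ (Fin n)) X]
  [IsManifold (𝓡 n) ∞ X] [ConnectedSpace X] {D₂ : InitialDataSet (𝓡 n) X}

/-! ### Realising a development of the sub-datum inside another one, relative version -/

/-- **Realising a development `𝒰` of the sub-datum inside a development `𝒟₁` of the sub-datum,
as a relative common sub-development of `𝒟₁` and a development `𝒟₂` of the datum** (relative
form of Sbierski 2016, §2, Remark (2) after Def. 2.4, with EXPLICIT witnesses): if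
`j : 𝒰 → 𝒟₁` is a smooth, time-orientation preserving, isometric open embedding with
`j ∘ ι_𝒰 = ι₁` and `k : 𝒰 → 𝒟₂` a smooth, time-orientation preserving isometric immersion with
`k ∘ ι_𝒰 = ι₂ ∘ Φ`, then `(U, ψ) = (j(𝒰), k ∘ j⁻¹)` satisfies the seven displayed conjuncts of
a relative common sub-development over `Φ`, and moreover `U = j(𝒰)` and `ψ ∘ j = k`. The proof
is that of `exists_realised_of_embedsInto` (the case `Φ = id`), verbatim.
[cite: Sbierski2016AHP, §2, Def. 2.4 and Remark (2)] -/
theorem exists_realised_rel (𝒰 𝒟₁ : CauchyDevelopment D₁) (𝒟₂ : CauchyDevelopment D₂)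
    {Φ : N → X} {j : 𝒰.carrier → 𝒟₁.carrier}
    (hjs : ContMDiff (𝓡 (n + 1)) (𝓡 (n + 1)) ∞ j) (hjo : IsOpenEmbedding j)
    (hji : 𝒰.metric.IsIsometricImmersion 𝒟₁.metric.toPseudoRiemannianMetric j)
    (hjt : 𝒰.timeOrientation.PreservesTimeOrientation j 𝒟₁.timeOrientation)
    (hjc : j ∘ 𝒰.embed = 𝒟₁.embed)
    {k : 𝒰.carrier → 𝒟₂.carrier} (hks : ContMDiff (𝓡 (n + 1)) (𝓡 (n + 1)) ∞ k)
    (hki : 𝒰.metric.IsIsometricImmersion 𝒟₂.metric.toPseudoRiemannianMetric k)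
    (hkt : 𝒰.timeOrientation.PreservesTimeOrientation k 𝒟₂.timeOrientation)
    (hkc : k ∘ 𝒰.embed = 𝒟₂.embed ∘ Φ) :
    ∃ (U : Opens 𝒟₁.carrier) (ψ : 𝒟₁.carrier → 𝒟₂.carrier),
      ((∀ u, 𝒟₁.embed u ∈ U) ∧ IsConnected (U : Set 𝒟₁.carrier) ∧
      (𝒟₁.metric.restrict PseudoRiemannianMetric.contMDiff_restrict_holds U).IsCauchyHypersurface
        (𝒟₁.timeOrientation.restrict PseudoRiemannianMetric.contMDiff_restrict_holds
          𝒟₁.timeOrientation.contMDiff_restrict_holds U) (Subtype.val ⁻¹' range 𝒟₁.embed) ∧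
      ContMDiffOn (𝓡 (n + 1)) (𝓡 (n + 1)) ∞ ψ U ∧
      (∀ p ∈ U, pullbackBilin (I := 𝓡 (n + 1)) (I' := 𝓡 (n + 1)) ψ 𝒟₂.metric.val p =
        𝒟₁.metric.val p) ∧
      (∀ p ∈ U, 𝒟₂.timeOrientation.IsFutureDirected
        (mfderiv (𝓡 (n + 1)) (𝓡 (n + 1)) ψ p (𝒟₁.timeOrientation.vectorField p))) ∧
      ψ ∘ 𝒟₁.embed = 𝒟₂.embed ∘ Φ) ∧
      (U : Set 𝒟₁.carrier) = range j ∧ ∀ x, ψ (j x) = k x := by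
  classical
  haveI : Nonempty 𝒰.carrier := inferInstance
  have hkd : MDifferentiable (𝓡 (n + 1)) (𝓡 (n + 1)) k := hks.mdifferentiable (by simp)
  set ji : 𝒟₁.carrier → 𝒰.carrier := invFun j with hji_def
  have hleft : ∀ x, ji (j x) = x := leftInverse_invFun hjo.injective
  have hright : ∀ p ∈ range j, j (ji p) = p := fun p hp ↦ invFun_eq hp
  have hjis : ContMDiffOn (𝓡 (n + 1)) (𝓡 (n + 1)) ∞ ji (range j) :=
    contMDiffOn_invFun_range (𝒮 := 𝒰.toSpacetime) (𝒮' := 𝒟₁.toSpacetime) hji hjo.injective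
  have hjid : ∀ p ∈ range j, MDifferentiableAt (𝓡 (n + 1)) (𝓡 (n + 1)) ji p := fun p hp ↦
    ((hjis p hp).contMDiffAt (hjo.isOpen_range.mem_nhds hp)).mdifferentiableAt (by simp)
  -- `dj (dj⁻¹ w) = w` on the range
  have hdd : ∀ (x : 𝒰.carrier) (w : TangentSpace (𝓡 (n + 1)) (j x)),
      mfderiv (𝓡 (n + 1)) (𝓡 (n + 1)) j (ji (j x)) (mfderiv (𝓡 (n + 1)) (𝓡 (n + 1)) ji (j x) w)
        = w :=
    mfderiv_comp_mfderiv_invFun (𝒮 := 𝒰.toSpacetime) (𝒮' := 𝒟₁.toSpacetime) hji hjo.injective hjo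
  -- scalar products: `g_𝒰 (dj⁻¹ v, dj⁻¹ w) = g₁ (v, w)` at points `j x`
  have hval : ∀ (x : 𝒰.carrier) (v w : TangentSpace (𝓡 (n + 1)) (j x)),
      𝒰.metric.val (ji (j x)) (mfderiv (𝓡 (n + 1)) (𝓡 (n + 1)) ji (j x) v)
        (mfderiv (𝓡 (n + 1)) (𝓡 (n + 1)) ji (j x) w) = 𝒟₁.metric.val (j x) v w := by
    intro x v w
    have h := congrArg (fun b ↦ b (mfderiv (𝓡 (n + 1)) (𝓡 (n + 1)) ji (j x) v)
      (mfderiv (𝓡 (n + 1)) (𝓡 (n + 1)) ji (j x) w)) (hji.2 (ji (j x)))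
    simp only [pullbackBilin_apply] at h
    rw [hdd, hdd] at h
    rw [hleft] at h ⊢
    exact h.symm
  -- future-directed vectors: `dj⁻¹ v` is future-directed if `v` is (converse timecone lemma)
  have hfut : ∀ (x : 𝒰.carrier) (v : TangentSpace (𝓡 (n + 1)) (j x)),
      𝒟₁.timeOrientation.IsFutureDirected v →
        𝒰.timeOrientation.IsFutureDirected (mfderiv (𝓡 (n + 1)) (𝓡 (n + 1)) ji (j x) v) := by
    intro x v hv
    refine hjt.isFutureDirected_of_mfderiv hji.2 ?_
    rw [hdd]
    rw [hleft]
    exact hv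
  refine ⟨⟨range j, hjo.isOpen_range⟩, k ∘ ji, ⟨fun u ↦ ?_, ?_, ?_, ?_, ?_, ?_, ?_⟩, rfl,
    fun x ↦ ?_⟩
  · -- `ι₁ u = j (ι_𝒰 u) ∈ range j`
    exact ⟨𝒰.embed u, congrFun hjc u⟩
  · -- connected
    exact isConnected_range hjs.continuous
  · -- `ι₁(N)` is a Cauchy hypersurface of the sub-spacetime `range j`
    intro γ s hγ
    obtain ⟨hs, hγt, hγf, hγp⟩ := hγ
    have hγM : 𝒟₁.metric.IsFutureTimelikeCurveOn 𝒟₁.timeOrientation (Subtype.val ∘ γ) s :=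
      (LorentzianMetric.isFutureTimelikeCurveOn_restrict_iff 𝒟₁.metric 𝒟₁.timeOrientation
        PseudoRiemannianMetric.contMDiff_restrict_holds
        𝒟₁.timeOrientation.contMDiff_restrict_holds _).1 hγt
    -- the pulled-back curve in `𝒰`
    set δ : ℝ → 𝒰.carrier := fun t ↦ ji (γ t : 𝒟₁.carrier) with hδ_def
    have hjδ : ∀ t, j (δ t) = (γ t : 𝒟₁.carrier) := fun t ↦ hright _ (γ t).2
    have hδt : 𝒰.metric.IsFutureTimelikeCurveOn 𝒰.timeOrientation δ s := by
      intro t ht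
      obtain ⟨hd, h1, h2⟩ := hγM t ht
      obtain ⟨x, hx⟩ := (γ t).2
      have hdδ : HasMFDerivAt 𝓘(ℝ, ℝ) (𝓡 (n + 1)) δ t
          ((mfderiv (𝓡 (n + 1)) (𝓡 (n + 1)) ji (γ t : 𝒟₁.carrier)).comp
            (mfderiv 𝓘(ℝ, ℝ) (𝓡 (n + 1)) (Subtype.val ∘ γ) t)) :=
        (hjid _ (γ t).2).hasMFDerivAt.comp t hd.hasMFDerivAt
      have hvel : velocity (𝓡 (n + 1)) δ t =
          mfderiv (𝓡 (n + 1)) (𝓡 (n + 1)) ji (γ t : 𝒟₁.carrier)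
            (velocity (𝓡 (n + 1)) (Subtype.val ∘ γ) t) := by
        simp only [velocity]; rw [hdδ.mfderiv]; rfl
      refine ⟨hdδ.mdifferentiableAt, ?_, ?_⟩
      · -- timelike
        change 𝒰.metric.val (δ t) (velocity (𝓡 (n + 1)) δ t) (velocity (𝓡 (n + 1)) δ t) < 0
        rw [hvel]
        have hv := hval x
        rw [hx] at hv
        rw [show δ t = ji (γ t : 𝒟₁.carrier) from rfl, hv]
        exact h1
      · -- future-directed
        rw [hvel]
        have hf := hfut x
        rw [hx] at hf
        exact hf _ h2
    -- endlessness transported along the homeomorphism `j : 𝒰 ≅ range j`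
    have hδf : IsFutureEndless δ s := by
      refine ⟨hγf.1, fun q hq ↦ hγf.2 ⟨j q, q, rfl⟩ ?_⟩
      have h1 : HasFutureEndpoint (j ∘ δ) s (j q) := (hjs.continuous.tendsto q).comp hq
      have h2 : HasFutureEndpoint (Subtype.val ∘ γ) s (j q) := h1.congr fun t ↦ hjδ t
      exact hasFutureEndpoint_subtypeVal_comp_iff.1 h2
    have hδp : IsPastEndless δ s := by
      refine ⟨hγp.1, fun q hq ↦ hγp.2 ⟨j q, q, rfl⟩ ?_⟩
      have h1 : HasPastEndpoint (j ∘ δ) s (j q) := (hjs.continuous.tendsto q).comp hq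
      have h2 : HasPastEndpoint (Subtype.val ∘ γ) s (j q) := h1.congr fun t ↦ hjδ t
      exact hasPastEndpoint_subtypeVal_comp_iff.1 h2
    -- `δ` meets `ι_𝒰(N)` exactly once; crossings correspond
    obtain ⟨t₀, ⟨ht₀s, u₀, hu₀⟩, huniq⟩ := 𝒰.isCauchyHypersurface δ s ⟨hs, hδt, hδf, hδp⟩
    refine ⟨t₀, ⟨ht₀s, u₀, ?_⟩, fun t ht ↦ huniq t ⟨ht.1, ?_⟩⟩
    · -- `γ t₀ = j (δ t₀) = j (ι_𝒰 u₀) = ι₁ u₀`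
      show 𝒟₁.embed u₀ = (γ t₀ : 𝒟₁.carrier)
      rw [← hjδ t₀, ← hu₀]; exact (congrFun hjc u₀).symm
    · obtain ⟨u, hu⟩ := ht.2
      refine ⟨u, ?_⟩
      show 𝒰.embed u = ji (γ t : 𝒟₁.carrier)
      rw [← hu, show 𝒟₁.embed u = j (𝒰.embed u) from (congrFun hjc u).symm, hleft]
  · -- smooth on `range j`
    exact hks.comp_contMDiffOn hjis
  · -- isometric on `range j`
    rintro _ ⟨x, rfl⟩
    ext v w
    have hc := mfderiv_comp (j x) (hkd (ji (j x))) (hjid (j x) ⟨x, rfl⟩)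
    have hk := congrArg (fun b ↦ b (mfderiv (𝓡 (n + 1)) (𝓡 (n + 1)) ji (j x) v)
      (mfderiv (𝓡 (n + 1)) (𝓡 (n + 1)) ji (j x) w)) (hki.2 (ji (j x)))
    simp only [pullbackBilin_apply] at hk ⊢
    rw [hc]
    exact hk.trans (hval x v w)
  · -- time-orientation preserving on `range j`
    rintro _ ⟨x, rfl⟩
    rw [mfderiv_comp (j x) (hkd (ji (j x))) (hjid (j x) ⟨x, rfl⟩)]
    exact hkt.isFutureDirected_mfderiv hki.2
      (hfut x _ (𝒟₁.timeOrientation.isFutureDirected_vectorField (j x)))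
  · -- `(k ∘ j⁻¹) ∘ ι₁ = k ∘ ι_𝒰 = ι₂ ∘ Φ`
    funext u
    show k (ji (𝒟₁.embed u)) = 𝒟₂.embed (Φ u)
    rw [show 𝒟₁.embed u = j (𝒰.embed u) from (congrFun hjc u).symm, hleft]
    exact congrFun hkc u
  · -- `ψ (j x) = k x`
    show k (ji (j x)) = k x
    rw [hleft]

/-! ### The item from MGHD existence -/

/-- **`SubdataDevelopmentsEmbed` from the existence of maximal globally hyperbolic vacuum
developments and the global hyperbolicity of Cauchy developments** (Hawking–Ellis 1973, §7.6,
p. 251; Choquet-Bruhat–Geroch 1969, p. 334): under the named facts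
`choquetBruhat_geroch_exists_mghd_cauchy` (Choquet-Bruhat–Geroch 1969, Thm. 3) and
`hawkingEllis_cauchyDevelopment_causalCompact_closed` (Hawking–Ellis 1973, Prop. 6.6.6; a theorem
of the tree, `…_holds`), every vacuum Cauchy development `𝒟'` of the sub-datum `Φ^* D` embeds
over `Φ` into every MAXIMAL vacuum Cauchy development `𝒟` of `D`. Proof: let `M̃` be a maximal
development of `Φ^* D` (the sub-datum is developable, by `𝒟'`; `N` inherits the Hausdorff and
second countability properties through the open embedding `Φ`), `R = (V, g|_V, ι ∘ Φ)` the domain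
of dependence of `ι(Φ N)` in `𝒟` (`exists_cauchyPieceDomain`), `θ : R → M̃` the embedding given
by maximality of `M̃`, `(U, ψ) = (θ(R), θ⁻¹)` the realised relative common sub-development of
`M̃` and `𝒟` (`exists_realised_rel`). A cluster point `q` of `ψ` at `∂U` lies off the closure of
the bad set of `K = ι(X) ∖ ι(Φ N)` (`not_mem_closure_badSet_of_clusterPt`), hence in `V = ψ(U)` —
impossible (`not_clusterPt_map_of_mem`). So `Z = 𝒟 ∪_ψ M̃` is a vacuum Cauchy development of
`D` receiving `M̃` over `Φ` (`hglue_of_relGluing`); `Z` embeds into the maximal `𝒟`, and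
`𝒟' → M̃ → Z → 𝒟` is the embedding. [cite: HawkingEllis1973CUP, §7.6, pp. 249–251]
[cite: ChoquetBruhatGeroch1969CMP, Thm. 3 and p. 334] -/
theorem subdataDevelopmentsEmbed_of_choquetBruhatGeroch_of_causalCompact
    (hcbg : choquetBruhat_geroch_exists_mghd_cauchy)
    (hgh : hawkingEllis_cauchyDevelopment_causalCompact_closed) :
    Summit.FinalStateConjecture.FinalStateConjecture.Theses.SwallowTheDatum.SubdataDevelopmentsEmbed := by
  unfold Theses.SwallowTheDatum.SubdataDevelopmentsEmbed
  intro X _ _ _ _ _ _ D 𝒟 hmax N _ _ _ _ Φ hΦ hΦ' hΦo 𝒟'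
  classical
  -- `N` is Hausdorff and second countable (open embedding into `X`)
  haveI : T2Space N := hΦo.isEmbedding.t2Space
  haveI : SecondCountableTopology N := hΦo.isEmbedding.secondCountableTopology
  -- a maximal development `M` of the sub-datum
  obtain ⟨M, hM⟩ := exists_isMaximal_of_nonempty_of_choquetBruhatGeroch hcbg N
    (D.comap Φ hΦ hΦ') ⟨𝒟'⟩
  -- the domain of dependence `V` of `ι(Φ N)` in `𝒟` and the development `R` of the sub-datum
  obtain ⟨n₀⟩ : Nonempty N := inferInstance
  have hslab : ∀ a ∈ range 𝒟.embed, ∃ ν : TangentSpace (𝓡 4) a,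
      𝒟.metric.IsTimelike ν ∧ 𝒟.timeOrientation.IsFutureDirected ν ∧
      ∀ κ : ℝ, 0 < κ → ∀ᶠ σ in 𝓝 a, σ ∈ range 𝒟.embed →
        |𝒟.metric.val a ν (extChartAt (𝓡 4) a σ - extChartAt (𝓡 4) a a)| ≤
          κ * ‖extChartAt (𝓡 4) a σ - extChartAt (𝓡 4) a a‖ := by
    rintro _ ⟨y, rfl⟩
    refine ⟨𝒟.normal y, ?_, 𝒟.isFutureUnitNormal.2 y, fun κ hκ ↦
      𝒟.toDataEmbedding.eventually_abs_val_normal_le y hκ⟩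
    show 𝒟.metric.val _ (𝒟.normal y) (𝒟.normal y) < 0
    rw [𝒟.isFutureUnitNormal.1.2 y]
    norm_num
  obtain ⟨V, -, hVc, hιV, hVcl, hVC⟩ := exists_cauchyPieceDomain 𝒟 hΦo hslab n₀
  have hν : ∀ u, MDifferentiableAt (𝓡 3) (𝓡 4).tangent
      (fun x ↦ (TotalSpace.mk' (EuclideanSpace ℝ (Fin 4)) (𝒟.embed x) (𝒟.normal x) :
        TangentBundle (𝓡 4) 𝒟.carrier)) (Φ u) := fun u ↦
    𝒟.toDataEmbedding.mdifferentiableAt_embed_normal (Φ u)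
  have hVC' : (𝒟.metric.restrict PseudoRiemannianMetric.contMDiff_restrict_holds V).IsCauchyHypersurface
      (𝒟.timeOrientation.restrict PseudoRiemannianMetric.contMDiff_restrict_holds
        𝒟.timeOrientation.contMDiff_restrict_holds V)
      (range ((𝒟.toDataEmbedding.comapAlong Φ hΦ hΦ' hΦo hν).embedOpens V hιV)) := by
    intro γ s hγ
    obtain ⟨t, ⟨hts, u, hu⟩, huniq⟩ := hVC γ s hγ
    refine ⟨t, ⟨hts, u, Subtype.ext hu⟩, fun t' ht' ↦ huniq t' ⟨ht'.1, ?_⟩⟩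
    obtain ⟨u', hu'⟩ := ht'.2
    exact ⟨u', congrArg Subtype.val hu'⟩
  set R : VacuumCauchyDevelopment (D.comap Φ hΦ hΦ') :=
    𝒟.comapAlongRestrict Φ hΦ hΦ' hΦo hν V hVc hιV hVC' with hR_def
  -- `θ : R → M` by maximality of `M`
  obtain ⟨θ, hθs, hθo, hθi, hθt, hθc⟩ := hM R
  -- the inclusion `k = Subtype.val : R → 𝒟` over `Φ`
  set k : R.carrier → 𝒟.carrier := fun y ↦ y.1 with hk_def
  have hks : ContMDiff (𝓡 4) (𝓡 4) ∞ k := contMDiff_subtype_val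
  have hki : R.metric.IsIsometricImmersion 𝒟.metric.toPseudoRiemannianMetric k := by
    refine ⟨hks, fun y ↦ ?_⟩
    ext v w
    rw [pullbackBilin_apply]
    change 𝒟.metric.val y.1 (mfderiv (𝓡 4) (𝓡 4) (Subtype.val : V → 𝒟.carrier) y v)
      (mfderiv (𝓡 4) (𝓡 4) (Subtype.val : V → 𝒟.carrier) y w) = 𝒟.metric.val y.1 v w
    rw [mfderiv_subtypeVal]
    rfl
  have hkt : R.timeOrientation.PreservesTimeOrientation k 𝒟.timeOrientation := fun y ↦ by
    change 𝒟.timeOrientation.IsFutureDirected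
      (mfderiv (𝓡 4) (𝓡 4) (Subtype.val : V → 𝒟.carrier) y (𝒟.timeOrientation.vectorField y.1))
    rw [mfderiv_subtypeVal]
    exact 𝒟.timeOrientation.isFutureDirected_vectorField y.1
  have hkc : k ∘ R.embed = 𝒟.embed ∘ Φ := rfl
  -- realise `R` inside `M` through `θ`: `(U, ψ) = (θ(R), val ∘ θ⁻¹)`
  obtain ⟨U, ψ, hP, hUeq, hψθ⟩ := exists_realised_rel R.toCauchyDevelopment M.toCauchyDevelopment
    𝒟.toCauchyDevelopment hθs hθo hθi hθt hθc hks hki hkt hkc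
  -- the image `ψ(U)` is `V`
  have himage : ψ '' (U : Set M.carrier) = (V : Set 𝒟.carrier) := by
    rw [hUeq]
    ext z
    constructor
    · rintro ⟨_, ⟨r, rfl⟩, rfl⟩
      rw [hψθ]
      exact r.2
    · intro hz
      exact ⟨θ ⟨z, hz⟩, ⟨⟨z, hz⟩, rfl⟩, by rw [hψθ]⟩
  -- global hyperbolicity of `𝒟` and `M` (theorems of the tree)
  obtain ⟨hK, hK', hrel⟩ := hgh X D 𝒟.toCauchyDevelopment
  obtain ⟨hK₁, hK₁', -⟩ := hgh N (D.comap Φ hΦ hΦ') M.toCauchyDevelopment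
  -- no cluster values of `ψ` at the frontier of `U`
  haveI : LocallyCompactSpace M.carrier :=
    ChartedSpace.locallyCompactSpace (EuclideanSpace ℝ (Fin 4)) M.carrier
  have hncb : ∀ p ∈ frontier (U : Set M.carrier), ∀ q : 𝒟.carrier,
      ¬ ClusterPt q (map ψ (𝓝[(U : Set M.carrier)] p)) := by
    intro p hp q hq
    obtain ⟨hqF, -, hinj, hopen, -⟩ := not_mem_closure_badSet_of_clusterPt 𝒟 hΦ hΦ' hΦo M
      hK hK' hK₁ hK₁' (fun hx hy hxy ↦ hrel _ _ _ _ hx hy hxy)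
      hslab U ψ hP hp hq
    -- `q ∈ closure ψ(U) = closure V`, hence `q ∈ V = ψ(U)`
    have hle : map ψ (𝓝[(U : Set M.carrier)] p) ≤ 𝓟 (ψ '' (U : Set M.carrier)) := by
      rw [← map_principal]
      exact map_mono (le_principal_iff.2 self_mem_nhdsWithin)
    have hqcl : q ∈ closure (ψ '' (U : Set M.carrier)) :=
      mem_closure_iff_clusterPt.2 (hq.mono hle)
    rw [himage] at hqcl
    have hqV : q ∈ (V : Set 𝒟.carrier) := hVcl ⟨hqcl, hqF⟩
    rw [← himage] at hqV
    obtain ⟨y₀, hy₀U, rfl⟩ := hqV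
    exact not_clusterPt_map_of_mem U.2 hinj hopen hp hy₀U hq
  -- the gluing `Z = 𝒟 ∪_ψ M`, receiving `M` over `Φ`
  obtain ⟨Z, jZ, j', ⟨-, -, -, -, -⟩, ⟨hj's, hj'o, hj'i, hj't, hj'c⟩, -⟩ :=
    hglue_of_relGluing M 𝒟 hΦo.injective U ψ hP hncb
  -- maximality of `𝒟` absorbs `Z`; `𝒟'` embeds into `M`
  obtain ⟨ζ, hζs, hζo, hζi, hζt, hζc⟩ := hmax Z
  obtain ⟨χ', hχ's, hχ'o, hχ'i, hχ't, hχ'c⟩ := hM 𝒟'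
  have hζj's : ContMDiff (𝓡 4) (𝓡 4) ∞ (ζ ∘ j') := hζs.comp hj's
  have hζj'i : M.metric.IsIsometricImmersion 𝒟.metric.toPseudoRiemannianMetric (ζ ∘ j') :=
    hζi.comp hj'i
  refine ⟨(ζ ∘ j') ∘ χ', hζj's.comp hχ's, (hζo.comp hj'o).comp hχ'o, hζj'i.comp hχ'i,
    (hζt.comp hj't hζi.2 (hζs.mdifferentiable (by simp)) (hj's.mdifferentiable (by simp))).comp
      hχ't hζj'i.2 (hζj's.mdifferentiable (by simp)) (hχ's.mdifferentiable (by simp)), ?_⟩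
  calc ((ζ ∘ j') ∘ χ') ∘ 𝒟'.embed = ζ ∘ j' ∘ (χ' ∘ 𝒟'.embed) := rfl
    _ = ζ ∘ (j' ∘ M.embed) := by rw [hχ'c]
    _ = ζ ∘ (Z.embed ∘ Φ) := by rw [hj'c]
    _ = (ζ ∘ Z.embed) ∘ Φ := rfl
    _ = 𝒟.embed ∘ Φ := by rw [hζc]

end SubdataDevelopmentsEmbed

end Summit.FinalStateConjecture.FinalStateConjecture.Theorems

end
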